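import Literature.AlgebraicGeometry.Resolution.StrictTransformFiniteFlatteningGeneral
import Literature.RingTheory.DedekindDomain.LocallyPrincipal
import Mathlib.RingTheory.Flat.TorsionFree
import Mathlib.RingTheory.RingHom.Flat
import Mathlib.AlgebraicGeometry.Noetherian
import HarnessLib

/-!
# Raynaud–Gruson flattening (Stacks 081R) over a Dedekind base

Topic: `Literature/AlgebraicGeometry/Resolution`. Over a Dedekind scheme `S` (integral, locally
Noetherian, the coordinate rings of its non-empty affine opens Dedekind domains) the flattening
theorem `Stacks081R` (`StrictTransformFlattening.lean`; Raynaud–Gruson 1971, Première partie,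
Thm. 5.2.2 = Stacks, Tag 081R) is elementary and needs no blowing up: for `U ⊆ S` a non-empty
quasi-compact open and `f : X → S` quasi-compact and locally of finite type with `X_U → U` flat,
an ideal sheaf `𝓚` of finite type with `V(𝓚) = S ∖ U` is an effective Cartier divisor
(non-zero ideals of a Dedekind domain being locally principal), so that the identity is the
blowing up of `S` in `𝓚`, and the strict transform of `X` — the scheme-theoretic closure of `X_U`
in `X` — is flat over `S`, being torsion free (EGA IV₂ 2.8.5: over a Dedekind base, flat = torsion
free), and locally of finite presentation, `S` being locally Noetherian.

* `flat_of_injective_pi` — over a Dedekind domain a module embedding into a product of flat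
  modules is flat;
* `isEffectiveCartier_of_isDedekindDomain` — an ideal sheaf non-zero on every non-empty affine
  open of a Dedekind scheme is an effective Cartier divisor;
* `flat_ker_subschemeι_comp` — for `S` affine Dedekind and `h : T → S` flat over `U`, the
  scheme-theoretic closure of `h⁻¹U` in `T` is flat over `S`;
* `stacks081R_isDedekindDomain` — **`Stacks081R` over a Dedekind base.**

## References

* The Stacks Project, Tag 081R; Tag 0AUW (flat = torsion free over Dedekind domains); Tag 080D.
  [StacksProject]
* A. Grothendieck, EGA IV₂, Prop. 2.8.5 (Publ. Math. IHÉS 24, 1965). [EGAIV2]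
* M. Raynaud, L. Gruson, *Critères de platitude et de projectivité*, Invent. Math. 13 (1971),
  Première partie, Thm. 5.2.2. [RaynaudGruson1971]
-/

noncomputable section

open CategoryTheory CategoryTheory.Limits AlgebraicGeometry TopologicalSpace

namespace Literature.AlgebraicGeometry.Resolution

universe u

open Literature.AlgebraicGeometry.Limits

/-! ## Algebra: torsion-free modules over a Dedekind domain -/

/-- Over a Dedekind domain, a module admitting an injective linear map into a product of flat
modules is flat (flat = torsion free, Stacks 0AUW). [cite: StacksProject, Tag 0AUW] -/
theorem flat_of_injective_pi {A : Type*} [CommRing A] [IsDedekindDomain A] {C : Type*}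
    [AddCommGroup C] [Module A C] {ι : Type*} (N : ι → Type*) [∀ i, AddCommGroup (N i)]
    [∀ i, Module A (N i)] [∀ i, Module.Flat A (N i)] (r : C →ₗ[A] ∀ i, N i)
    (hr : Function.Injective r) : Module.Flat A C := by
  haveI : Module.IsTorsionFree A (∀ i, N i) :=
    ⟨fun a ha x y hxy => funext fun i => (ha.isSMulRegular (M := N i)) (congrFun hxy i)⟩
  haveI : Module.IsTorsionFree A C := hr.moduleIsTorsionFree r (fun a c => r.map_smul a c)
  infer_instance

/-! ## Effective Cartier divisors on a Dedekind scheme -/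

/-- **An ideal sheaf which is non-zero on every non-empty affine open of a Dedekind scheme is an
effective Cartier divisor**: at a point `x` of an affine open `W = Spec A`, `A` Dedekind, the
non-zero ideal `𝓚(W)` becomes principal, generated by a non-zero `y ∈ 𝓚(W)`, on a basic open
`D(g) ∋ x` (`Literature.RingTheory.DedekindDomain.exists_notMem_and_map_eq_span`), and `y` is a
non-zero-divisor of the domain `Γ(S, D(g))`. [cite: StacksProject, Tag 0AUW] -/
theorem isEffectiveCartier_of_isDedekindDomain {S : Scheme.{u}} [IsIntegral S]
    (hS : ∀ W : S.affineOpens, ((W : S.Opens) : Set S).Nonempty → IsDedekindDomain Γ(S, W))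
    (K : S.IdealSheafData)
    (hK : ∀ W : S.affineOpens, ((W : S.Opens) : Set S).Nonempty → K.ideal W ≠ ⊥) :
    IsEffectiveCartier K := by
  intro x
  obtain ⟨W, hW, hxW, -⟩ :=
    exists_isAffineOpen_mem_and_subset (X := S) (x := x) (U := ⊤) (Opens.mem_top x)
  let Wa : S.affineOpens := ⟨W, hW⟩
  haveI : IsDedekindDomain Γ(S, Wa) := hS Wa ⟨x, hxW⟩
  let p := (hW.primeIdealOf ⟨x, hxW⟩).asIdeal
  obtain ⟨g, hgp, y, hyK, hy0, hloc⟩ :=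
    Literature.RingTheory.DedekindDomain.exists_notMem_and_map_eq_span (hK Wa ⟨x, hxW⟩) p
  -- `x ∈ D(g)`
  have hxg : x ∈ S.basicOpen g := by
    letI := TopCat.Presheaf.algebra_section_stalk S.presheaf (⟨x, hxW⟩ : W)
    haveI := hW.isLocalization_stalk ⟨x, hxW⟩
    rw [S.mem_basicOpen g x hxW]
    exact (IsLocalization.AtPrime.isUnit_to_map_iff (S.presheaf.stalk x)
      (hW.primeIdealOf ⟨x, hxW⟩).asIdeal g).mpr hgp
  haveI := hW.isLocalization_basicOpen g
  have hg0 : g ≠ 0 := fun h => hgp (h ▸ p.zero_mem)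
  haveI : Nonempty (S.basicOpen g) := ⟨⟨x, hxg⟩⟩
  haveI : IsDomain Γ(S, S.basicOpen g) := IsIntegral.component_integral (S.basicOpen g)
  refine ⟨S.affineBasicOpen g, hxg, S.presheaf.map (homOfLE (S.basicOpen_le g)).op y, ?_, ?_⟩
  · change _ ∈ nonZeroDivisors Γ(S, S.basicOpen g)
    refine mem_nonZeroDivisors_of_ne_zero fun h => hy0 ?_
    exact IsLocalization.injective Γ(S, S.basicOpen g)
      (powers_le_nonZeroDivisors_of_noZeroDivisors hg0) (h.trans (map_zero _).symm)
  · rw [← K.map_ideal (U := S.affineBasicOpen g) (V := Wa) (S.basicOpen_le g)]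
    exact hloc Γ(S, S.basicOpen g)

/-! ## The scheme-theoretic closure of `h⁻¹U` is flat over an affine Dedekind base -/

section Closure

variable {T S : Scheme.{u}} [IsAffine S] (h : T ⟶ S) (U : S.Opens)

omit [IsAffine S] in
/-- On an affine open `V` of `T`, the kernel of the restriction to `V ∩ h⁻¹U`, `U = ⋃ D(aᵢ)`,
consists of the sections killed by a power of every `h♯aᵢ`. [folklore] -/
theorem ker_ι_app_iff [QuasiCompact (h ⁻¹ᵁ U).ι] {ι : Type*} (a : ι → Γ(S, ⊤))
    (hUa : U = ⨆ i, S.basicOpen (a i)) (V : T.affineOpens) (z : Γ(T, V)) :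
    z ∈ (h ⁻¹ᵁ U).ι.ker.ideal V ↔
      ∀ i, ∃ m : ℕ, (h.appLE ⊤ V le_top (a i)) ^ m * z = 0 := by
  classical
  -- the basic opens `D(bᵢ) = V ∩ h⁻¹D(aᵢ)` cover `V ∩ h⁻¹U`
  set b : ι → Γ(T, V) := fun i => h.appLE ⊤ V le_top (a i) with hb
  have hDb : ∀ i, T.basicOpen (b i) = (V : T.Opens) ⊓ h ⁻¹ᵁ S.basicOpen (a i) := fun i => by
    rw [hb]
    change T.basicOpen ((h.app ⊤ ≫ T.presheaf.map (homOfLE _).op) (a i)) = _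
    rw [CommRingCat.comp_apply, Scheme.basicOpen_res, ← Scheme.preimage_basicOpen]
  have hcov : (V : T.Opens) ⊓ h ⁻¹ᵁ U = ⨆ i, T.basicOpen (b i) := by
    simp_rw [hDb, hUa, Scheme.Hom.preimage_iSup, inf_iSup_eq]
  have hle : ∀ i, T.basicOpen (b i) ≤ (V : T.Opens) := fun i => T.basicOpen_le _
  rw [Scheme.Hom.ker_apply, RingHom.mem_ker, Scheme.Opens.ι_app]
  -- the image of `ι` composed with the preimage is `V ∩ h⁻¹U`
  have himg : (h ⁻¹ᵁ U).ι ''ᵁ (h ⁻¹ᵁ U).ι ⁻¹ᵁ (V : T.Opens) = (V : T.Opens) ⊓ h ⁻¹ᵁ U := by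
    rw [Scheme.Hom.image_preimage_eq_opensRange_inf, Scheme.Opens.opensRange_ι, inf_comm]
  constructor
  · intro hz i
    replace hz : (T.presheaf.map (homOfLE (Set.image_preimage_subset _ _) :
        (h ⁻¹ᵁ U).ι ''ᵁ (h ⁻¹ᵁ U).ι ⁻¹ᵁ (V : T.Opens) ⟶ (V : T.Opens)).op) z = 0 := hz
    haveI := V.2.isLocalization_basicOpen (b i)
    have hres : T.presheaf.map (homOfLE (hle i)).op z = 0 := by
      have hle' : T.basicOpen (b i) ≤ (h ⁻¹ᵁ U).ι ''ᵁ (h ⁻¹ᵁ U).ι ⁻¹ᵁ (V : T.Opens) := by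
        rw [himg, hcov]
        exact le_iSup (fun i => T.basicOpen (b i)) i
      have : T.presheaf.map (homOfLE (hle i)).op =
          T.presheaf.map (homOfLE (Set.image_preimage_subset _ _) :
            (h ⁻¹ᵁ U).ι ''ᵁ (h ⁻¹ᵁ U).ι ⁻¹ᵁ (V : T.Opens) ⟶ (V : T.Opens)).op ≫
            T.presheaf.map (homOfLE hle').op := by
        rw [← T.presheaf.map_comp]
        rfl
      rw [this, CommRingCat.comp_apply, hz, map_zero]
    obtain ⟨⟨_, m, rfl⟩, hm⟩ :=
      (IsLocalization.map_eq_zero_iff (Submonoid.powers (b i)) Γ(T, T.basicOpen (b i)) z).mp hres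
    exact ⟨m, hm⟩
  · intro hz
    -- a section vanishing on each `D(bᵢ)` vanishes on their union
    have key : ∀ (O : T.Opens) (hO : O = ⨆ i, T.basicOpen (b i)) (hOV : O ≤ (V : T.Opens)),
        T.presheaf.map (homOfLE hOV).op z = 0 := by
      rintro _ rfl hOV
      refine TopCat.Sheaf.eq_of_locally_eq' T.sheaf (fun i => T.basicOpen (b i)) _
        (fun i => homOfLE (le_iSup (fun i => T.basicOpen (b i)) i)) le_rfl _ _ fun i => ?_
      change (T.presheaf.map (homOfLE (le_iSup (fun i => T.basicOpen (b i)) i)).op)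
          ((T.presheaf.map (homOfLE hOV).op) z) =
        (T.presheaf.map (homOfLE (le_iSup (fun i => T.basicOpen (b i)) i)).op) 0
      rw [map_zero, ← CommRingCat.comp_apply, ← T.presheaf.map_comp]
      change T.presheaf.map (homOfLE (hle i)).op z = 0
      haveI := V.2.isLocalization_basicOpen (b i)
      obtain ⟨m, hm⟩ := hz i
      exact (IsLocalization.map_eq_zero_iff (Submonoid.powers (b i)) Γ(T, T.basicOpen (b i)) z).mpr
        ⟨⟨_, m, rfl⟩, hm⟩
    exact key _ (himg.trans hcov) _

/-- **The scheme-theoretic closure of `h⁻¹U` in `T` is flat over an affine Dedekind base `S`**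
when `h : T → S` is flat over the quasi-compact open `U ⊆ S`: on an affine open `V` of `T` its
sections are `Γ(T, V)` modulo the sections killed by powers of the `h♯aᵢ` (`U = ⋃ D(aᵢ)`), which
embeds into `∏ Γ(T, V ∩ h⁻¹D(aᵢ))`, a flat `Γ(S, 𝒪_S)`-module; over a Dedekind domain torsion
free modules are flat (Stacks 0AUW; EGA IV₂ 2.8.5). [cite: EGAIV2, Prop. 2.8.5] -/
theorem flat_ker_subschemeι_comp (hA : IsDedekindDomain Γ(S, ⊤)) (hU : IsCompact (U : Set S))
    [QuasiCompact (h ⁻¹ᵁ U).ι] (hflat : Flat (h ∣_ U)) :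
    Flat ((h ⁻¹ᵁ U).ι.ker.subschemeι ≫ h) := by
  classical
  haveI := hA
  set K' := (h ⁻¹ᵁ U).ι.ker with hK'
  -- `U = ⋃ D(aᵢ)`
  obtain ⟨s, hs, hUs⟩ :=
    isCompact_and_isOpen_iff_finite_and_eq_biUnion_basicOpen.mp ⟨hU, U.2⟩
  let a : s → Γ(S, ⊤) := Subtype.val
  have hUa : U = ⨆ i : s, S.basicOpen (a i) := by
    apply le_antisymm
    · intro x hx
      have hx' : x ∈ (U : Set S) := hx
      rw [hUs] at hx'
      obtain ⟨r, hr, hxr⟩ := Set.mem_iUnion₂.mp hx'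
      exact Opens.mem_iSup.mpr ⟨⟨r, hr⟩, hxr⟩
    · refine iSup_le fun i x hx => ?_
      change x ∈ (U : Set S)
      rw [hUs]
      exact Set.mem_biUnion i.2 hx
  have hDU : ∀ i : s, S.basicOpen (a i) ≤ U := fun i => hUa ▸ le_iSup (fun i => S.basicOpen (a i)) i
  -- flatness is checked on the affine opens `X' ∩ V`, `V ⊆ T` affine
  refine HasRingHomProperty.of_iSup_eq_top (P := @Flat)
    (fun V : T.affineOpens => ⟨K'.subschemeι ⁻¹ᵁ (V : T.Opens), V.2.preimage K'.subschemeι⟩)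
    ?_ fun V => ?_
  · change ⨆ V : T.affineOpens, K'.subschemeι ⁻¹ᵁ (V : T.Opens) = ⊤
    rw [← Scheme.Hom.preimage_iSup, iSup_affineOpens_eq_top]
    rfl
  -- the ring map `A → Γ(X', X' ∩ V)` is `A → B = Γ(T, V) → B/K'(V) ≅ Γ(X', X' ∩ V)`
  have hcomp : (K'.subschemeι ≫ h).appLE ⊤ (K'.subschemeι ⁻¹ᵁ (V : T.Opens)) le_top =
      h.appLE ⊤ V le_top ≫ CommRingCat.ofHom (Ideal.Quotient.mk (K'.ideal V)) ≫
        (K'.subschemeObjIso V).inv := by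
    rw [← K'.subschemeι_app V, ← Scheme.Hom.appLE_eq_app, Scheme.Hom.appLE_comp_appLE]
  change ((K'.subschemeι ≫ h).appLE ⊤ (K'.subschemeι ⁻¹ᵁ (V : T.Opens)) le_top).hom.Flat
  rw [hcomp, ← Category.assoc, CommRingCat.hom_comp, RingHom.Flat.respectsIso.cancel_right_isIso,
    CommRingCat.hom_comp, CommRingCat.hom_ofHom]
  -- Algebra: `A → B/K'(V)` is flat
  set φ : Γ(S, ⊤) →+* Γ(T, V) := (h.appLE ⊤ V le_top).hom with hφ
  set b : s → Γ(T, V) := fun i => φ (a i) with hb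
  -- the flat `A`-algebras `Γ(T, D(bᵢ)) = Γ(T, V ∩ h⁻¹D(aᵢ))`
  have hbD : ∀ i, T.basicOpen (b i) ≤ h ⁻¹ᵁ S.basicOpen (a i) := fun i => by
    rw [hb]
    change T.basicOpen ((h.app ⊤ ≫ T.presheaf.map (homOfLE _).op) (a i)) ≤ _
    rw [CommRingCat.comp_apply, Scheme.basicOpen_res, ← Scheme.preimage_basicOpen]
    exact inf_le_right
  let ψ : ∀ i : s, Γ(S, ⊤) →+* Γ(T, T.basicOpen (b i)) := fun i =>
    (T.presheaf.map (homOfLE (T.basicOpen_le (b i))).op).hom.comp φ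
  have hψ : ∀ i, (ψ i).Flat := fun i => by
    have h1 : (h.appLE (S.basicOpen (a i)) (T.basicOpen (b i)) (hbD i)).hom.Flat :=
      appLE_of_morphismRestrict @Flat h U hflat
        ⟨S.basicOpen (a i), (isAffineOpen_top S).basicOpen _⟩ (hDU i)
        ⟨T.basicOpen (b i), V.2.basicOpen _⟩ (hbD i)
    have h2 : (S.presheaf.map (homOfLE (S.basicOpen_le (a i))).op).hom.Flat := by
      haveI := (isAffineOpen_top S).isLocalization_basicOpen (a i)
      exact RingHom.flat_algebraMap_iff.mpr (IsLocalization.flat _ (Submonoid.powers (a i)))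
    have h12 := h2.comp h1
    have heq : (h.appLE (S.basicOpen (a i)) (T.basicOpen (b i)) (hbD i)).hom.comp
        (S.presheaf.map (homOfLE (S.basicOpen_le (a i))).op).hom = ψ i := by
      change (S.presheaf.map (homOfLE (S.basicOpen_le (a i))).op ≫
        h.appLE (S.basicOpen (a i)) (T.basicOpen (b i)) (hbD i)).hom =
        (h.appLE ⊤ V le_top ≫ T.presheaf.map (homOfLE (T.basicOpen_le (b i))).op).hom
      rw [Scheme.Hom.map_appLE, Scheme.Hom.appLE_map]
    rwa [heq] at h12
  -- module structures through `φ` and the `ψᵢ`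
  letI algC := ((Ideal.Quotient.mk (K'.ideal V)).comp φ).toAlgebra
  letI algN : ∀ i : s, Algebra Γ(S, ⊤) Γ(T, T.basicOpen (b i)) := fun i => (ψ i).toAlgebra
  haveI : ∀ i : s, Module.Flat Γ(S, ⊤) Γ(T, T.basicOpen (b i)) := fun i => hψ i
  -- the embedding `B/K'(V) → ∏ Γ(T, D(bᵢ))`
  have hkerV : ∀ z : Γ(T, V), z ∈ K'.ideal V ↔ ∀ i, ∃ m : ℕ, b i ^ m * z = 0 :=
    ker_ι_app_iff h U a hUa V
  let r₀ : Γ(T, V) ⧸ K'.ideal V →+* ∀ i : s, Γ(T, T.basicOpen (b i)) :=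
    RingHom.pi fun i => Ideal.Quotient.lift (K'.ideal V)
      (T.presheaf.map (homOfLE (T.basicOpen_le (b i))).op).hom fun z hz => by
        haveI := V.2.isLocalization_basicOpen (b i)
        obtain ⟨m, hm⟩ := (hkerV z).mp hz i
        exact (IsLocalization.map_eq_zero_iff (Submonoid.powers (b i)) Γ(T, T.basicOpen (b i))
          z).mpr ⟨⟨_, m, rfl⟩, hm⟩
  have hr₀ : Function.Injective r₀ := by
    rw [injective_iff_map_eq_zero]
    intro q hq
    obtain ⟨z, rfl⟩ := Ideal.Quotient.mk_surjective q
    refine Ideal.Quotient.eq_zero_iff_mem.mpr ((hkerV z).mpr fun i => ?_)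
    haveI := V.2.isLocalization_basicOpen (b i)
    have hi : T.presheaf.map (homOfLE (T.basicOpen_le (b i))).op z = 0 := congrFun hq i
    obtain ⟨⟨_, m, rfl⟩, hm⟩ :=
      (IsLocalization.map_eq_zero_iff (Submonoid.powers (b i)) Γ(T, T.basicOpen (b i)) z).mp hi
    exact ⟨m, hm⟩
  let r : (Γ(T, V) ⧸ K'.ideal V) →ₗ[Γ(S, ⊤)] ∀ i : s, Γ(T, T.basicOpen (b i)) :=
    { toFun := r₀
      map_add' := map_add r₀
      map_smul' := fun c q => by
        obtain ⟨z, rfl⟩ := Ideal.Quotient.mk_surjective q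
        rw [RingHom.id_apply, Algebra.smul_def, map_mul]
        funext i
        rw [Pi.mul_apply, Pi.smul_apply, Algebra.smul_def]
        rfl }
  change Module.Flat Γ(S, ⊤) (Γ(T, V) ⧸ K'.ideal V)
  exact flat_of_injective_pi (fun i : s => Γ(T, T.basicOpen (b i))) r hr₀

end Closure

/-! ## `Stacks081R` over a Dedekind base -/

/-- Being a Dedekind domain is invariant under ring isomorphisms. [folklore] -/
theorem isDedekindDomain_of_ringEquiv {A B : Type*} [CommRing A] [CommRing B] [IsDedekindDomain A]
    (e : A ≃+* B) : IsDedekindDomain B := by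
  haveI : IsDomain B := MulEquiv.isDomain A e.symm.toMulEquiv
  haveI : IsNoetherianRing B := isNoetherianRing_of_ringEquiv A e
  haveI : Ring.DimensionLEOne B := Ring.DimensionLEOne.of_ringEquiv e.symm
  haveI : IsIntegrallyClosed B := IsIntegrallyClosed.of_equiv e
  exact { }

/-- **Stacks 081R (Raynaud–Gruson 5.2.2) over a Dedekind base.** Let `S` be a Dedekind scheme —
quasi-compact, quasi-separated, integral, locally Noetherian, the coordinate rings of its
non-empty affine opens Dedekind domains —, `f : X → S` quasi-compact and locally of finite type,
and `U ⊆ S` a non-empty quasi-compact open with `X_U → U` flat. Then there are an ideal sheaf `𝓘`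
of finite type on `S` with support disjoint from `U` and a blowing up `b : S' → S` of `S` in `𝓘`
such that the strict transform of `X` along `b` is flat and locally of finite presentation over
`S'`. Indeed no blowing up is needed: locally on `S` one may take `b = 𝟙` and `𝓘 ⊇` an ideal
sheaf of finite type with `V(𝓘) = S ∖ U`, an effective Cartier divisor
(`isEffectiveCartier_of_isDedekindDomain`); the strict transform, the scheme-theoretic closure
of `X_U`, is flat over the Dedekind base (`flat_ker_subschemeι_comp`, EGA IV₂ 2.8.5) and locally
of finite presentation as `S` is locally Noetherian; the local data glue by
`exists_isBlowup_flat_lfp_of_forall_affineOpens_base`. (The conclusion is that of the named fact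
`Stacks081R`, whose hypotheses allow any quasi-compact quasi-separated `S`.)
[cite: StacksProject, Tag 081R; EGAIV2, Prop. 2.8.5; RaynaudGruson1971, Première partie Thm. 5.2.2] -/
theorem stacks081R_isDedekindDomain ⦃X S : Scheme.{u}⦄ (f : X ⟶ S) [CompactSpace S]
    [QuasiSeparatedSpace S] [IsIntegral S] [IsLocallyNoetherian S]
    (hS : ∀ W : S.affineOpens, ((W : S.Opens) : Set S).Nonempty → IsDedekindDomain Γ(S, W))
    [QuasiCompact f] [LocallyOfFiniteType f] (U : S.Opens) (hU : IsCompact (U : Set S))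
    (hUne : (U : Set S).Nonempty) (hflat : Flat (f ∣_ U)) :
    ∃ (I : S.IdealSheafData) (S' : Scheme.{u}) (b : S' ⟶ S),
      (∀ W : S.affineOpens, (I.ideal W).FG) ∧ Disjoint (U : Set S) (I.support : Set S) ∧
      IsBlowup b I ∧ Flat (blowupStrictTransformMap f b I) ∧
      LocallyOfFinitePresentation (blowupStrictTransformMap f b I) := by
  classical
  -- a centre with support exactly `S ∖ U`, an effective Cartier divisor
  obtain ⟨K, hKfg, hKsupp⟩ := exists_fg_support_eq_compl U hU
  have hKU : centreCompl K = U := centreCompl_eq_of_support_eq hKsupp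
  have hKne : ∀ W : S.affineOpens, ((W : S.Opens) : Set S).Nonempty → K.ideal W ≠ ⊥ := by
    intro W hW hKW
    -- `W ⊆ V(K) = S ∖ U`, but `W` meets the dense open `U`
    obtain ⟨x, hxW, hxU⟩ : ((W : S.Opens) ∩ (U : Set S) : Set S).Nonempty :=
      nonempty_preirreducible_inter (W : S.Opens).2 U.2 hW hUne
    have hxK : x ∈ (K.support : Set S) := by
      rw [SetLike.mem_coe, Scheme.IdealSheafData.mem_support_iff_of_mem (I := K) (U := W) hxW,
        hKW, Scheme.mem_zeroLocus_iff]
      intro g hg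
      rw [show g = 0 from hg, Scheme.basicOpen_zero]
      exact id
    rw [hKsupp] at hxK
    exact hxK hxU
  have hE : IsEffectiveCartier K := isEffectiveCartier_of_isDedekindDomain hS K hKne
  -- glue the local (trivial) blowing ups
  refine exists_isBlowup_flat_lfp_of_forall_affineOpens_base f U hU fun T => ?_
  haveI : IsAffine (T : Scheme.{u}) := T.2
  haveI : QuasiCompact (T : S.Opens).ι := quasiCompact_ι_of_isCompact _ T.2.isCompact
  rcases isEmpty_or_nonempty (T : Scheme.{u}) with hT | hT
  · -- an empty member of the cover: everything is empty
    refine ⟨⊤, T, 𝟙 _, fun W => ⟨{1}, by simp [Scheme.IdealSheafData.ideal_top]⟩, ?_,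
      isBlowup_id_top _, inferInstance, inferInstance⟩
    rw [Scheme.IdealSheafData.support_top]
    exact disjoint_bot_right
  -- a non-empty affine `T = Spec A`, `A` Dedekind: take `b = 𝟙` and the centre `K|_T`
  let ιT := (T : S.Opens).ι
  let fT := pullback.snd f ιT
  have hTne : ((T : S.Opens) : Set S).Nonempty := by
    obtain ⟨t⟩ := hT
    exact ⟨t.1, t.2⟩
  have hA : IsDedekindDomain Γ((T : Scheme.{u}), ⊤) := by
    haveI := hS T hTne
    exact isDedekindDomain_of_ringEquiv (T : S.Opens).topIso.commRingCatIsoToRingEquiv.symm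
  have hET : IsEffectiveCartier (K.comap ιT) := hE.comap_ι _
  -- the open `U|_T` in its various guises
  have hU₁ : (𝟙 (T : Scheme.{u})) ⁻¹ᵁ centreCompl (K.comap ιT) = ιT ⁻¹ᵁ U := by
    rw [← preimage_centreCompl, hKU]
    rfl
  have hUT : IsCompact (((𝟙 (T : Scheme.{u})) ⁻¹ᵁ centreCompl (K.comap ιT) :
      (T : Scheme.{u}).Opens) : Set (T : Scheme.{u})) := by
    rw [hU₁]
    exact ιT.isCompact_preimage hU
  haveI : QuasiCompact ((pullback.snd fT (𝟙 (T : Scheme.{u}))) ⁻¹ᵁ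
      ((𝟙 (T : Scheme.{u})) ⁻¹ᵁ centreCompl (K.comap ιT))).ι := by
    rw [preimage_centreCompl]
    exact quasiCompact_ι_preimage_centreCompl _
      (by rw [Scheme.IdealSheafData.comap_id]; exact hET)
  have hflatT : Flat ((pullback.snd fT (𝟙 (T : Scheme.{u}))) ∣_
      (𝟙 (T : Scheme.{u})) ⁻¹ᵁ centreCompl (K.comap ιT)) := by
    rw [hU₁]
    exact pullback_snd_morphismRestrict_preimage @Flat fT (𝟙 _) (ιT ⁻¹ᵁ U)
      (pullback_snd_morphismRestrict_preimage @Flat f ιT U hflat)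
  refine ⟨K.comap ιT, T, 𝟙 _, fg_ideal_comap ιT hKfg, ?_, IsBlowup.id hET, ?_, ?_⟩
  · rw [Scheme.IdealSheafData.support_comap, Closeds.coe_preimage, hKsupp, Set.preimage_compl]
    exact disjoint_compl_right
  · exact flat_ker_subschemeι_comp (pullback.snd fT (𝟙 (T : Scheme.{u}))) _ hA hUT hflatT
  · haveI : LocallyOfFiniteType (blowupStrictTransformMap fT (𝟙 (T : Scheme.{u})) (K.comap ιT)) := by
      unfold blowupStrictTransformMap
      infer_instance
    exact (LocallyOfFinitePresentation.iff_locallyOfFiniteType).mpr inferInstance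

end Literature.AlgebraicGeometry.Resolution

end
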